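import Mathlib
import Summits.MatrixMultiplication.MatrixMultiplication.Theorems.SubgroupIdentityDesigns.Negative.OrbitPair

/-!
# The unimodular-coset certificate: vectors fixed by elements of a common determinant `d₀ ≠ 1`

Route `LevelGradedCohnUmans`, crux `SubgroupIdentityDesigns`, the `(m,k) = (2,1)` cell, `p`-free
case.  A SINGLE-MEMBER exclusion engine, uniform in `p`, with no TPP and no volume hypothesis:
if a member `Hᵢ` contains a subgroup `K` and some `d₀ ≠ 1` such that EVERY non-zero vector is
fixed by an element of `K` of determinant `d₀`, then the triple carries no level-one identity
design.  Certificate: `λ = 1_{K ∩ SL₂} - 1_{s₀ (K ∩ SL₂)}` (`det s₀ = d₀`); for each `a ≠ 0` with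
fixer `s_a`, `k ↦ s₀⁻¹ k s_a` re-indexes `K ∩ SL₂` with `s₀ (s₀⁻¹ k s_a) a = k a`, so this is an
ORBIT PAIR and `OrbitPair` applies.  Instances (numerically certified in the route folder):
`O₂⁻(𝔽_p)` and everything containing it (reflections, `d₀ = -1`), the monomial groups `K_Δ` with
`-1 ∈ Δ`, `GL(2,3) < GL₂(𝔽₁₁)` and `Z·GL(2,3)` (reflections), `Z·2O < GL₂(𝔽₇)` (`d₀` a cube root
of unity), `Z·2I < GL₂(𝔽₁₁)` (`d₀` a fifth root of unity).
`no_levelOne_design_of_detFixers₁/₂/₃`.  VALUE = THEOREM, NOT summit progress; the crux item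
stmt-MatrixMultiplication-14079 is untouched and remains open.
-/

set_option linter.dupNamespace false

noncomputable section

open scoped BigOperators Classical

open Summit.MatrixMultiplication.MatrixMultiplication.Theorems.LieRankDesigns.Negative (GLm Mat)

namespace Summit.MatrixMultiplication.MatrixMultiplication.Theorems.SubgroupIdentityDesigns.Negative

section DetFixers

variable {p : ℕ} [hp : Fact p.Prime]

/-- Determinant of a `GL₂` element as a matrix determinant, multiplicative bookkeeping. -/
theorem det_coe_mul_three (x y z : GLm p 2) :
    Matrix.det ((x * y * z : GLm p 2) : Mat p 2) =
      Matrix.det (x : Mat p 2) * Matrix.det (y : Mat p 2) * Matrix.det (z : Mat p 2) := by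
  rw [Units.val_mul, Units.val_mul, Matrix.det_mul, Matrix.det_mul]

/-- `det (x⁻¹) = (det x)⁻¹` for `x ∈ GL₂(𝔽_p)`. -/
theorem det_coe_inv (x : GLm p 2) :
    Matrix.det ((x⁻¹ : GLm p 2) : Mat p 2) = (Matrix.det (x : Mat p 2))⁻¹ := by
  have hx : Matrix.det (x : Mat p 2) ≠ 0 := Matrix.GeneralLinearGroup.det_ne_zero x
  have h1 : Matrix.det ((x⁻¹ : GLm p 2) : Mat p 2) * Matrix.det (x : Mat p 2) = 1 := by
    rw [← Matrix.det_mul, ← Units.val_mul, inv_mul_cancel, Units.val_one, Matrix.det_one]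
  exact eq_inv_of_mul_eq_one_left h1

/-- **The orbit pair of the unimodular-coset certificate.** -/
theorem orbitPair_of_detFixers (K : Subgroup (GLm p 2)) (d₀ : ZMod p)
    (hfix : ∀ a : Fin 2 → ZMod p, a ≠ 0 → ∃ s ∈ K,
      ((s : GLm p 2) : Mat p 2).mulVec a = a ∧ Matrix.det ((s : GLm p 2) : Mat p 2) = d₀)
    (s₀ : GLm p 2) (hs₀ : s₀ ∈ K) (hs₀d : Matrix.det ((s₀ : GLm p 2) : Mat p 2) = d₀)
    (K₁ : Finset (GLm p 2))
    (hK₁ : ∀ k : GLm p 2, k ∈ K₁ ↔ k ∈ K ∧ Matrix.det ((k : GLm p 2) : Mat p 2) = 1) :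
    ∀ a : Fin 2 → ZMod p, a ≠ 0 → ∃ e : K₁ ≃ K₁, ∀ k : K₁,
      ((s₀ * (e k : GLm p 2) : GLm p 2) : Mat p 2).mulVec a =
        ((k : GLm p 2) : Mat p 2).mulVec a := by
  intro a ha
  obtain ⟨s, hsK, hsa, hsd⟩ := hfix a ha
  have hd₀ : d₀ ≠ 0 := by rw [← hs₀d]; exact Matrix.GeneralLinearGroup.det_ne_zero s₀
  have hto : ∀ k : GLm p 2, k ∈ K₁ → s₀⁻¹ * k * s ∈ K₁ := by
    intro k hk
    rw [hK₁] at hk ⊢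
    refine ⟨K.mul_mem (K.mul_mem (K.inv_mem hs₀) hk.1) hsK, ?_⟩
    rw [det_coe_mul_three, det_coe_inv, hs₀d, hk.2, hsd, mul_one, inv_mul_cancel₀ hd₀]
  have hfrom : ∀ k : GLm p 2, k ∈ K₁ → s₀ * k * s⁻¹ ∈ K₁ := by
    intro k hk
    rw [hK₁] at hk ⊢
    refine ⟨K.mul_mem (K.mul_mem hs₀ hk.1) (K.inv_mem hsK), ?_⟩
    rw [det_coe_mul_three, det_coe_inv, hs₀d, hk.2, hsd, mul_one, mul_inv_cancel₀ hd₀]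
  refine ⟨⟨fun k => ⟨s₀⁻¹ * k * s, hto k k.2⟩, fun k => ⟨s₀ * k * s⁻¹, hfrom k k.2⟩,
    fun k => Subtype.ext (by simp only; group), fun k => Subtype.ext (by simp only; group)⟩,
    fun k => ?_⟩
  show ((s₀ * (s₀⁻¹ * k * s) : GLm p 2) : Mat p 2).mulVec a = ((k : GLm p 2) : Mat p 2).mulVec a
  rw [show s₀ * (s₀⁻¹ * (k : GLm p 2) * s) = k * s by group, Units.val_mul,
    ← Matrix.mulVec_mulVec, hsa]

/-- **Unimodular-coset certificate, member `H₁`.**  All `p`; no TPP. -/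
theorem no_levelOne_design_of_detFixers₁ {H₁ H₂ H₃ : Subgroup (GLm p 2)} (K : Subgroup (GLm p 2))
    (hKH : K ≤ H₁) (d₀ : ZMod p) (hd₀ : d₀ ≠ 1)
    (hfix : ∀ a : Fin 2 → ZMod p, a ≠ 0 → ∃ s ∈ K,
      ((s : GLm p 2) : Mat p 2).mulVec a = a ∧ Matrix.det ((s : GLm p 2) : Mat p 2) = d₀) :
    ¬ ∃ c : Mat p 2 → ℂ, (∀ M, 1 < M.rank → c M = 0) ∧
      (∑ M, c M * ZMod.stdAddChar (Matrix.trace (M * ((1 : GLm p 2) : Mat p 2)))) = 1 ∧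
      ∀ a ∈ H₁, ∀ b ∈ H₂, ∀ g ∈ H₃, a * b * g ≠ 1 →
        (∑ M, c M *
          ZMod.stdAddChar (Matrix.trace (M * ((a * b * g : GLm p 2) : Mat p 2)))) = 0 := by
  have h10 : (fun _ : Fin 2 => (1 : ZMod p)) ≠ 0 := fun h => one_ne_zero (congr_fun h 0)
  obtain ⟨s₀, hs₀, -, hs₀d⟩ := hfix _ h10
  set K₁ : Finset (GLm p 2) :=
    Finset.univ.filter (fun k => k ∈ K ∧ Matrix.det ((k : GLm p 2) : Mat p 2) = 1) with hK₁def
  have hK₁ : ∀ k : GLm p 2, k ∈ K₁ ↔ k ∈ K ∧ Matrix.det ((k : GLm p 2) : Mat p 2) = 1 := by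
    intro k; rw [hK₁def, Finset.mem_filter]; simp
  refine no_levelOne_design_of_orbit_pair_mem₁ K₁ s₀ (fun k hk => hKH ((hK₁ k).mp hk).1)
    (hKH hs₀) ((hK₁ 1).mpr ⟨K.one_mem, by rw [Units.val_one, Matrix.det_one]⟩)
    (fun k hk h1 => hd₀ ?_) (orbitPair_of_detFixers K d₀ hfix s₀ hs₀ hs₀d K₁ hK₁)
  have := congrArg (fun x : GLm p 2 => Matrix.det (x : Mat p 2)) h1
  simp only [Units.val_mul, Matrix.det_mul, hs₀d, ((hK₁ k).mp hk).2, mul_one, Units.val_one,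
    Matrix.det_one] at this
  exact this

/-- **Unimodular-coset certificate, member `H₂`.**  All `p`; no TPP. -/
theorem no_levelOne_design_of_detFixers₂ {H₁ H₂ H₃ : Subgroup (GLm p 2)} (K : Subgroup (GLm p 2))
    (hKH : K ≤ H₂) (d₀ : ZMod p) (hd₀ : d₀ ≠ 1)
    (hfix : ∀ a : Fin 2 → ZMod p, a ≠ 0 → ∃ s ∈ K,
      ((s : GLm p 2) : Mat p 2).mulVec a = a ∧ Matrix.det ((s : GLm p 2) : Mat p 2) = d₀) :
    ¬ ∃ c : Mat p 2 → ℂ, (∀ M, 1 < M.rank → c M = 0) ∧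
      (∑ M, c M * ZMod.stdAddChar (Matrix.trace (M * ((1 : GLm p 2) : Mat p 2)))) = 1 ∧
      ∀ a ∈ H₁, ∀ b ∈ H₂, ∀ g ∈ H₃, a * b * g ≠ 1 →
        (∑ M, c M *
          ZMod.stdAddChar (Matrix.trace (M * ((a * b * g : GLm p 2) : Mat p 2)))) = 0 := by
  have h10 : (fun _ : Fin 2 => (1 : ZMod p)) ≠ 0 := fun h => one_ne_zero (congr_fun h 0)
  obtain ⟨s₀, hs₀, -, hs₀d⟩ := hfix _ h10
  set K₁ : Finset (GLm p 2) :=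
    Finset.univ.filter (fun k => k ∈ K ∧ Matrix.det ((k : GLm p 2) : Mat p 2) = 1) with hK₁def
  have hK₁ : ∀ k : GLm p 2, k ∈ K₁ ↔ k ∈ K ∧ Matrix.det ((k : GLm p 2) : Mat p 2) = 1 := by
    intro k; rw [hK₁def, Finset.mem_filter]; simp
  refine no_levelOne_design_of_orbit_pair_mem₂ K₁ s₀ (fun k hk => hKH ((hK₁ k).mp hk).1)
    (hKH hs₀) ((hK₁ 1).mpr ⟨K.one_mem, by rw [Units.val_one, Matrix.det_one]⟩)
    (fun k hk h1 => hd₀ ?_) (orbitPair_of_detFixers K d₀ hfix s₀ hs₀ hs₀d K₁ hK₁)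
  have := congrArg (fun x : GLm p 2 => Matrix.det (x : Mat p 2)) h1
  simp only [Units.val_mul, Matrix.det_mul, hs₀d, ((hK₁ k).mp hk).2, mul_one, Units.val_one,
    Matrix.det_one] at this
  exact this

/-- **Unimodular-coset certificate, member `H₃`.**  All `p`; no TPP. -/
theorem no_levelOne_design_of_detFixers₃ {H₁ H₂ H₃ : Subgroup (GLm p 2)} (K : Subgroup (GLm p 2))
    (hKH : K ≤ H₃) (d₀ : ZMod p) (hd₀ : d₀ ≠ 1)
    (hfix : ∀ a : Fin 2 → ZMod p, a ≠ 0 → ∃ s ∈ K,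
      ((s : GLm p 2) : Mat p 2).mulVec a = a ∧ Matrix.det ((s : GLm p 2) : Mat p 2) = d₀) :
    ¬ ∃ c : Mat p 2 → ℂ, (∀ M, 1 < M.rank → c M = 0) ∧
      (∑ M, c M * ZMod.stdAddChar (Matrix.trace (M * ((1 : GLm p 2) : Mat p 2)))) = 1 ∧
      ∀ a ∈ H₁, ∀ b ∈ H₂, ∀ g ∈ H₃, a * b * g ≠ 1 →
        (∑ M, c M *
          ZMod.stdAddChar (Matrix.trace (M * ((a * b * g : GLm p 2) : Mat p 2)))) = 0 := by
  have h10 : (fun _ : Fin 2 => (1 : ZMod p)) ≠ 0 := fun h => one_ne_zero (congr_fun h 0)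
  obtain ⟨s₀, hs₀, -, hs₀d⟩ := hfix _ h10
  set K₁ : Finset (GLm p 2) :=
    Finset.univ.filter (fun k => k ∈ K ∧ Matrix.det ((k : GLm p 2) : Mat p 2) = 1) with hK₁def
  have hK₁ : ∀ k : GLm p 2, k ∈ K₁ ↔ k ∈ K ∧ Matrix.det ((k : GLm p 2) : Mat p 2) = 1 := by
    intro k; rw [hK₁def, Finset.mem_filter]; simp
  refine no_levelOne_design_of_orbit_pair_mem₃ K₁ s₀ (fun k hk => hKH ((hK₁ k).mp hk).1)
    (hKH hs₀) ((hK₁ 1).mpr ⟨K.one_mem, by rw [Units.val_one, Matrix.det_one]⟩)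
    (fun k hk h1 => hd₀ ?_) (orbitPair_of_detFixers K d₀ hfix s₀ hs₀ hs₀d K₁ hK₁)
  have := congrArg (fun x : GLm p 2 => Matrix.det (x : Mat p 2)) h1
  simp only [Units.val_mul, Matrix.det_mul, hs₀d, ((hK₁ k).mp hk).2, mul_one, Units.val_one,
    Matrix.det_one] at this
  exact this

end DetFixers

end Summit.MatrixMultiplication.MatrixMultiplication.Theorems.SubgroupIdentityDesigns.Negative

end
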